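import Summits.Ventures.LatticeQCDFlow.Scaling.SimulatedTemperingTarget

/-!
HONEST FRAMING: exact (Metropolis-corrected) sampling algorithms for lattice gauge theory; figures
of merit are autocorrelation/cost numbers at stated couplings and volumes; no continuum-physics
claim.

# SimulatedTemperingLevelKernel — THE EXACT-WEIGHT METROPOLIS LEVEL MOVE OF SIMULATED TEMPERING AS A MARKOV
# KERNEL ON `Fin (K+1) × Ω`: NEAREST-NEIGHBOUR MOVES WITH PROBABILITIES EQUAL TO HALF THE METROPOLIS RATIOS
# (lean-2 GEN-14, ours)

Venture-side (OURS).  Cell `lqcd-flow` (pub-lqcd), unit `pub-lqcd-lean-2-g14`, 2026-08-24.  GEN-13's level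
autocorrelation law of simulated tempering (`Scaling/SimulatedTemperingDiffusive.st_level_lagOneAutocorr_ge`)
quantifies over ALL Markov kernels `κ` on `Fin (K+1) × Ω` that (i) leave the exact-weight target
`stTarget X μ β K = (K+1)⁻¹·Σ_k δ_k ⊗ μ_{β_k}` invariant, (ii) move the level by at most one rung per step and
(iii) move it up / down from `(k, x)` with probability at most the exact-weight Metropolis ratio
`min(1, p_{β_{k±1}}(x)/p_{β_k}(x))` (`p_u = e^{uX}/mgf(u)`), and NO kernel was constructed there.  This file
CONSTRUCTS the textbook one — the Metropolis level update of Marinari–Parisi simulated tempering / the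
Lyubartsev et al. expanded ensemble with exact free-energy weights — as a Mathlib `ProbabilityTheory.Kernel`
and proves (ii) and (iii) for it; the companion `Scaling/SimulatedTemperingLevelKernelBalance` proves (i) in
the strong form of DETAILED BALANCE (`Kernel.IsReversible`).  So the hypotheses of the GEN-13 laws (and of the
reversible `τ_int` floor) are inhabited by the algorithm they describe.

## The kernel (`X : Ω → ℝ` measurable, `μ` a measure on `Ω`, levels `β : ℕ → ℝ`, `K : ℕ`)

From `(k, x)`: propose `k + 1` or `k − 1` with probability `½` each; accept with the exact-weight Metropolis
ratio; proposals off the ladder are rejected: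

  `κ(k, x) = u(k,x)·δ_{(k+1, x)} + d(k,x)·δ_{(k−1, x)} + (1 − u(k,x) − d(k,x))·δ_{(k, x)}`,
  `u(k,x) = ½·1[k<K]·min(1, p_{β_{k+1}}(x)/p_{β_k}(x))`, `d(k,x) = ½·1[k≥1]·min(1, p_{β_{k−1}}(x)/p_{β_k}(x))`.

## What is defined / proved

* §1 `stUpProb`, `stDownProb` (= `u`, `d`): measurable, `∈ [0, ½]`, `2(u + d) = stLevelMoveRatio`
  (`two_mul_stUpProb_add_stDownProb`), `u ≤ min(1, p_{k+1}/p_k)`, `d ≤ min(1, p_{k−1}/p_k)`;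
  `levUp K k = min(k+1, K)`, `levDown K k = k − 1` on `Fin (K+1)`; `measurable_indicator_one_comp`;
  `lintegral_stTarget` (`∫⁻ g dπ = (K+1)⁻¹Σ_k ∫⁻ g(k,·) dμ_{β_k}` for measurable `g ≥ 0`).
* §2 `stLevelMeasure` and **`stLevelKernel hXm μ β K`** (a `Kernel (Fin (K+1) × Ω) (Fin (K+1) × Ω)`),
  **`isMarkovKernel_stLevelKernel`**; its value on measurable sets (`stLevelKernel_apply'`) and
  `lintegral_stLevelKernel` (`∫⁻ g dκ(z,·) = u·g(k+1,x) + d·g(k−1,x) + (1−u−d)·g(z)`).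
* §3 (ii) **`stLevelKernel_nearestNeighbour`** — `|level(y) − level(z)| ≤ 1` for `κ(z,·)`-a.e. `y`;
  (iii) **`stLevelKernel_real_up`** / **`stLevelKernel_real_down`** — the probability of moving up / down from
  `(k, x)` IS `u(k,x)` / `d(k,x)`, hence `≤ min(1, p_{β_{k±1}}(x)/p_{β_k}(x))` (**`stLevelKernel_hup`**,
  **`stLevelKernel_hdown`** — literally hypotheses (iii) of `st_level_lagOneAutocorr_ge`).

NOT CLAIMED: ergodicity of anything (the level kernel alone never moves `x`; it is to be composed / mixed with
`μ_{β_k}`-preserving within-level dynamics); other proposal schemes (always-propose at the ends,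
non-nearest-neighbour, Gibbs level updates) — each satisfies (i)–(iii) as well but is not typed here; estimated
(non-exact) weights.  Literature grade (cell rule): TEXTBOOK ALGORITHM (Marinari–Parisi, Europhys. Lett. 19
(1992) 451; Lyubartsev–Martsinovski–Shevkunov–Vorontsov-Velyaminov, J. Chem. Phys. 96 (1992) 1776;
Geyer–Thompson, J. Amer. Statist. Assoc. 90 (1995) 909), NEW TYPING (Mathlib `Kernel` on a general measurable
`Ω`); nothing cited as a fact; no new bib keys.
-/

noncomputable section

open MeasureTheory ProbabilityTheory Set Filter Finset
open scoped ENNReal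

namespace Summit.Ventures.LatticeQCDFlow.Scaling

/-! ## §1 The move probabilities and the level successor / predecessor -/

section Moves

variable {Ω : Type*} [MeasurableSpace Ω]

/-- **Up-move probability** of the exact-weight Metropolis level update from `(k, x)`:
`½·min(1, p_{β_{k+1}}(x)/p_{β_k}(x))` if `k < K`, else `0` (proposal `k+1` with probability `½`). [ours] -/
def stUpProb (X : Ω → ℝ) (μ : Measure Ω) (β : ℕ → ℝ) (K : ℕ) (z : Fin (K + 1) × Ω) : ℝ :=
  if ((z.1 : Fin (K + 1)) : ℕ) < K then
    1 / 2 * min 1 ((Real.exp (β ((z.1 : ℕ) + 1) * X z.2) / mgf X μ (β ((z.1 : ℕ) + 1))) /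
      (Real.exp (β (z.1 : ℕ) * X z.2) / mgf X μ (β (z.1 : ℕ))))
  else 0

/-- **Down-move probability** of the exact-weight Metropolis level update from `(k, x)`:
`½·min(1, p_{β_{k−1}}(x)/p_{β_k}(x))` if `k ≥ 1`, else `0` (proposal `k−1` with probability `½`). [ours] -/
def stDownProb (X : Ω → ℝ) (μ : Measure Ω) (β : ℕ → ℝ) (K : ℕ) (z : Fin (K + 1) × Ω) : ℝ :=
  if 1 ≤ ((z.1 : Fin (K + 1)) : ℕ) then
    1 / 2 * min 1 ((Real.exp (β ((z.1 : ℕ) - 1) * X z.2) / mgf X μ (β ((z.1 : ℕ) - 1))) /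
      (Real.exp (β (z.1 : ℕ) * X z.2) / mgf X μ (β (z.1 : ℕ))))
  else 0

/-- The level successor, capped at the top rung: `levUp K k = min(k+1, K)`. [ours] -/
def levUp (K : ℕ) (k : Fin (K + 1)) : Fin (K + 1) := ⟨min ((k : ℕ) + 1) K, Nat.lt_succ_of_le (min_le_right _ _)⟩

/-- The level predecessor (`0 − 1 = 0`): `levDown K k = k − 1`. [ours] -/
def levDown (K : ℕ) (k : Fin (K + 1)) : Fin (K + 1) := ⟨(k : ℕ) - 1, lt_of_le_of_lt (Nat.sub_le _ _) k.isLt⟩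

variable {X : Ω → ℝ} {μ : Measure Ω} {β : ℕ → ℝ} {K : ℕ}

/-- Lebesgue integration against the simulated-tempering target:
`∫⁻ g dπ = (K+1)⁻¹·Σ_k ∫⁻ g(k, x) dμ_{β_k}(x)` for measurable `g`. [ours] -/
theorem lintegral_stTarget {g : Fin (K + 1) × Ω → ℝ≥0∞} (hg : Measurable g) :
    ∫⁻ z, g z ∂(stTarget X μ β K) =
      ((K + 1 : ℕ) : ℝ≥0∞)⁻¹ * ∑ k : Fin (K + 1), ∫⁻ x, g (k, x) ∂(μ.tilted fun x => β k * X x) := by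
  unfold stTarget
  rw [lintegral_smul_measure, lintegral_finsetSum_measure, smul_eq_mul]
  congr 1
  refine Finset.sum_congr rfl fun k _ => ?_
  rw [lintegral_map hg measurable_prodMk_left]

/-- The value of the capped successor. [ours] -/
@[simp] theorem levUp_val (k : Fin (K + 1)) : ((levUp K k : Fin (K + 1)) : ℕ) = min ((k : ℕ) + 1) K := rfl

/-- The value of the predecessor. [ours] -/
@[simp] theorem levDown_val (k : Fin (K + 1)) : ((levDown K k : Fin (K + 1)) : ℕ) = (k : ℕ) - 1 := rfl

/-- Below the top rung the successor is `k + 1`. [ours] -/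
theorem levUp_val_of_lt {k : Fin (K + 1)} (hk : (k : ℕ) < K) : ((levUp K k : Fin (K + 1)) : ℕ) = (k : ℕ) + 1 := by
  rw [levUp_val]; exact min_eq_left (Nat.succ_le_of_lt hk)

/-- The tilted densities are nonnegative ratios, so every Metropolis ratio is `≥ 0`. [folklore] -/
theorem st_ratio_nonneg (s t : ℝ) (x : Ω) :
    0 ≤ (Real.exp (t * X x) / mgf X μ t) / (Real.exp (s * X x) / mgf X μ s) :=
  div_nonneg (div_nonneg (Real.exp_pos _).le mgf_nonneg) (div_nonneg (Real.exp_pos _).le mgf_nonneg)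

/-- `0 ≤ u`. [ours] -/
theorem stUpProb_nonneg (z : Fin (K + 1) × Ω) : 0 ≤ stUpProb X μ β K z := by
  unfold stUpProb
  split_ifs
  · exact mul_nonneg (by norm_num) (le_min zero_le_one (st_ratio_nonneg _ _ _))
  · exact le_rfl

/-- `0 ≤ d`. [ours] -/
theorem stDownProb_nonneg (z : Fin (K + 1) × Ω) : 0 ≤ stDownProb X μ β K z := by
  unfold stDownProb
  split_ifs
  · exact mul_nonneg (by norm_num) (le_min zero_le_one (st_ratio_nonneg _ _ _))
  · exact le_rfl

/-- `u ≤ ½` (the proposal probability). [ours] -/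
theorem stUpProb_le_half (z : Fin (K + 1) × Ω) : stUpProb X μ β K z ≤ 1 / 2 := by
  unfold stUpProb
  split_ifs
  · have := min_le_left (1 : ℝ) ((Real.exp (β ((z.1 : ℕ) + 1) * X z.2) / mgf X μ (β ((z.1 : ℕ) + 1))) /
      (Real.exp (β (z.1 : ℕ) * X z.2) / mgf X μ (β (z.1 : ℕ))))
    linarith
  · norm_num

/-- `d ≤ ½` (the proposal probability). [ours] -/
theorem stDownProb_le_half (z : Fin (K + 1) × Ω) : stDownProb X μ β K z ≤ 1 / 2 := by
  unfold stDownProb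
  split_ifs
  · have := min_le_left (1 : ℝ) ((Real.exp (β ((z.1 : ℕ) - 1) * X z.2) / mgf X μ (β ((z.1 : ℕ) - 1))) /
      (Real.exp (β (z.1 : ℕ) * X z.2) / mgf X μ (β (z.1 : ℕ))))
    linarith
  · norm_num

/-- The stay probability `1 − u − d` is nonnegative. [ours] -/
theorem stStayProb_nonneg (z : Fin (K + 1) × Ω) : 0 ≤ 1 - stUpProb X μ β K z - stDownProb X μ β K z := by
  linarith [stUpProb_le_half (X := X) (μ := μ) (β := β) z, stDownProb_le_half (X := X) (μ := μ) (β := β) z]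

/-- `2·(u + d) = stLevelMoveRatio`: the move probabilities are half the dominating ratios of GEN-13. [ours] -/
theorem two_mul_stUpProb_add_stDownProb (z : Fin (K + 1) × Ω) :
    2 * (stUpProb X μ β K z + stDownProb X μ β K z) = stLevelMoveRatio X μ β K z := by
  unfold stUpProb stDownProb stLevelMoveRatio
  split_ifs <;> ring

/-- `u ≤ min(1, p_{β_{k+1}}/p_{β_k})` for `k < K`. [ours] -/
theorem stUpProb_le_ratio (k : Fin (K + 1)) (x : Ω) (hk : (k : ℕ) < K) :
    stUpProb X μ β K (k, x) ≤ min 1 ((Real.exp (β ((k : ℕ) + 1) * X x) / mgf X μ (β ((k : ℕ) + 1))) /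
      (Real.exp (β (k : ℕ) * X x) / mgf X μ (β (k : ℕ)))) := by
  unfold stUpProb
  rw [if_pos hk]
  linarith [le_min zero_le_one (st_ratio_nonneg (X := X) (μ := μ) (β (k : ℕ)) (β ((k : ℕ) + 1)) x)]

/-- `d ≤ min(1, p_{β_{k−1}}/p_{β_k})` for `k ≥ 1`. [ours] -/
theorem stDownProb_le_ratio (k : Fin (K + 1)) (x : Ω) (hk : 1 ≤ (k : ℕ)) :
    stDownProb X μ β K (k, x) ≤ min 1 ((Real.exp (β ((k : ℕ) - 1) * X x) / mgf X μ (β ((k : ℕ) - 1))) /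
      (Real.exp (β (k : ℕ) * X x) / mgf X μ (β (k : ℕ)))) := by
  unfold stDownProb
  rw [if_pos hk]
  linarith [le_min zero_le_one (st_ratio_nonneg (X := X) (μ := μ) (β (k : ℕ)) (β ((k : ℕ) - 1)) x)]

/-- Measurability of the up-move probability. [ours] -/
theorem measurable_stUpProb (hXm : Measurable X) : Measurable (stUpProb X μ β K) := by
  refine measurable_from_prod_countable_right fun k => ?_
  have hp : ∀ u : ℝ, Measurable fun x : Ω => Real.exp (u * X x) / mgf X μ u := fun u =>
    (Real.measurable_exp.comp (hXm.const_mul u)).div_const _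
  unfold stUpProb
  by_cases hk : ((k : Fin (K + 1)) : ℕ) < K
  · simp only [hk, if_true]
    exact (measurable_const.min ((hp _).div (hp _))).const_mul _
  · simp only [hk, if_false]; exact measurable_const

/-- Measurability of the down-move probability. [ours] -/
theorem measurable_stDownProb (hXm : Measurable X) : Measurable (stDownProb X μ β K) := by
  refine measurable_from_prod_countable_right fun k => ?_
  have hp : ∀ u : ℝ, Measurable fun x : Ω => Real.exp (u * X x) / mgf X μ u := fun u =>
    (Real.measurable_exp.comp (hXm.const_mul u)).div_const _
  unfold stDownProb
  by_cases hk : 1 ≤ ((k : Fin (K + 1)) : ℕ)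
  · simp only [hk, if_true]
    exact (measurable_const.min ((hp _).div (hp _))).const_mul _
  · simp only [hk, if_false]; exact measurable_const

/-- Indicators of measurable sets pulled back along measurable maps are measurable (as `ℝ≥0∞`-valued
functions). [folklore] -/
theorem measurable_indicator_one_comp {α γ : Type*} [MeasurableSpace α] [MeasurableSpace γ] {g : α → γ}
    (hg : Measurable g) {s : Set γ} (hs : MeasurableSet s) :
    Measurable fun a => s.indicator (1 : γ → ℝ≥0∞) (g a) := by
  classical
  simp only [Set.indicator_apply]
  exact Measurable.ite (hg hs) measurable_const measurable_const

end Moves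

/-! ## §2 The kernel -/

section KernelDef

variable {Ω : Type*} [MeasurableSpace Ω]

/-- The transition measure of the exact-weight Metropolis level update from `z = (k, x)`:
`u(z)·δ_{(k+1,x)} + d(z)·δ_{(k−1,x)} + (1 − u(z) − d(z))·δ_z`. [ours] -/
def stLevelMeasure (X : Ω → ℝ) (μ : Measure Ω) (β : ℕ → ℝ) (K : ℕ) (z : Fin (K + 1) × Ω) :
    Measure (Fin (K + 1) × Ω) :=
  ENNReal.ofReal (stUpProb X μ β K z) • Measure.dirac ((levUp K z.1, z.2) : Fin (K + 1) × Ω) +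
    ENNReal.ofReal (stDownProb X μ β K z) • Measure.dirac ((levDown K z.1, z.2) : Fin (K + 1) × Ω) +
    ENNReal.ofReal (1 - stUpProb X μ β K z - stDownProb X μ β K z) • Measure.dirac z

variable {X : Ω → ℝ} {μ : Measure Ω} {β : ℕ → ℝ} {K : ℕ}

/-- `z ↦ (levUp z.1, z.2)` is measurable. [folklore] -/
theorem measurable_levUp_prod : Measurable fun z : Fin (K + 1) × Ω => ((levUp K z.1, z.2) : Fin (K + 1) × Ω) :=
  ((measurable_of_countable (levUp K)).comp measurable_fst).prodMk measurable_snd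

/-- `z ↦ (levDown z.1, z.2)` is measurable. [folklore] -/
theorem measurable_levDown_prod :
    Measurable fun z : Fin (K + 1) × Ω => ((levDown K z.1, z.2) : Fin (K + 1) × Ω) :=
  ((measurable_of_countable (levDown K)).comp measurable_fst).prodMk measurable_snd

/-- The transition measure on a measurable set. [ours] -/
theorem stLevelMeasure_apply' (z : Fin (K + 1) × Ω) {s : Set (Fin (K + 1) × Ω)} (hs : MeasurableSet s) :
    stLevelMeasure X μ β K z s =
      ENNReal.ofReal (stUpProb X μ β K z) * s.indicator 1 ((levUp K z.1, z.2) : Fin (K + 1) × Ω) +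
        ENNReal.ofReal (stDownProb X μ β K z) * s.indicator 1 ((levDown K z.1, z.2) : Fin (K + 1) × Ω) +
        ENNReal.ofReal (1 - stUpProb X μ β K z - stDownProb X μ β K z) * s.indicator 1 z := by
  simp only [stLevelMeasure, Measure.coe_add, Measure.coe_smul, Pi.add_apply, Pi.smul_apply, smul_eq_mul,
    Measure.dirac_apply' _ hs]

/-- `z ↦ κ(z, ·)` is measurable (for measurable `X`). [ours] -/
theorem measurable_stLevelMeasure (hXm : Measurable X) : Measurable (stLevelMeasure X μ β K) := by
  have hu : Measurable fun z : Fin (K + 1) × Ω => ENNReal.ofReal (stUpProb X μ β K z) :=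
    (measurable_stUpProb (μ := μ) (β := β) (K := K) hXm).ennreal_ofReal
  have hd : Measurable fun z : Fin (K + 1) × Ω => ENNReal.ofReal (stDownProb X μ β K z) :=
    (measurable_stDownProb (μ := μ) (β := β) (K := K) hXm).ennreal_ofReal
  have hs : Measurable fun z : Fin (K + 1) × Ω =>
      ENNReal.ofReal (1 - stUpProb X μ β K z - stDownProb X μ β K z) :=
    ((measurable_const.sub (measurable_stUpProb (μ := μ) (β := β) (K := K) hXm)).sub
      (measurable_stDownProb (μ := μ) (β := β) (K := K) hXm)).ennreal_ofReal
  refine Measure.measurable_of_measurable_coe _ fun s hsm => ?_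
  simp only [stLevelMeasure_apply' _ hsm]
  have h1 : Measurable fun z : Fin (K + 1) × Ω =>
      s.indicator (1 : Fin (K + 1) × Ω → ℝ≥0∞) ((levUp K z.1, z.2) : Fin (K + 1) × Ω) :=
    measurable_indicator_one_comp measurable_levUp_prod hsm
  have h2 : Measurable fun z : Fin (K + 1) × Ω =>
      s.indicator (1 : Fin (K + 1) × Ω → ℝ≥0∞) ((levDown K z.1, z.2) : Fin (K + 1) × Ω) :=
    measurable_indicator_one_comp measurable_levDown_prod hsm
  have h3 : Measurable fun z : Fin (K + 1) × Ω => s.indicator (1 : Fin (K + 1) × Ω → ℝ≥0∞) z :=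
    measurable_indicator_one_comp measurable_id hsm
  exact ((hu.mul h1).add (hd.mul h2)).add (hs.mul h3)

/-- **THE EXACT-WEIGHT METROPOLIS LEVEL KERNEL OF SIMULATED TEMPERING** on `Fin (K+1) × Ω`: from `(k, x)`
propose `k ± 1` with probability `½` each and accept with `min(1, p_{β_{k±1}}(x)/p_{β_k}(x))`,
`p_u = e^{uX}/mgf(u)`; off-ladder proposals are rejected. [ours] -/
def stLevelKernel {X : Ω → ℝ} (hXm : Measurable X) (μ : Measure Ω) (β : ℕ → ℝ) (K : ℕ) :
    Kernel (Fin (K + 1) × Ω) (Fin (K + 1) × Ω) :=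
  ⟨stLevelMeasure X μ β K, measurable_stLevelMeasure hXm⟩

/-- The level kernel at `z` is the transition measure `stLevelMeasure … z`. [ours] -/
theorem stLevelKernel_apply (hXm : Measurable X) (z : Fin (K + 1) × Ω) :
    stLevelKernel hXm μ β K z = stLevelMeasure X μ β K z := rfl

/-- The level kernel on a measurable set. [ours] -/
theorem stLevelKernel_apply' (hXm : Measurable X) (z : Fin (K + 1) × Ω) {s : Set (Fin (K + 1) × Ω)}
    (hs : MeasurableSet s) :
    stLevelKernel hXm μ β K z s =
      ENNReal.ofReal (stUpProb X μ β K z) * s.indicator 1 ((levUp K z.1, z.2) : Fin (K + 1) × Ω) +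
        ENNReal.ofReal (stDownProb X μ β K z) * s.indicator 1 ((levDown K z.1, z.2) : Fin (K + 1) × Ω) +
        ENNReal.ofReal (1 - stUpProb X μ β K z - stDownProb X μ β K z) * s.indicator 1 z := by
  rw [stLevelKernel_apply, stLevelMeasure_apply' _ hs]

/-- The level kernel is a MARKOV kernel (`u, d ∈ [0, ½]`). [ours] -/
instance isMarkovKernel_stLevelKernel (hXm : Measurable X) : IsMarkovKernel (stLevelKernel hXm μ β K) := by
  refine ⟨fun z => ⟨?_⟩⟩
  rw [stLevelKernel_apply' hXm z MeasurableSet.univ]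
  simp only [Set.indicator_univ, Pi.one_apply, mul_one]
  rw [← ENNReal.ofReal_add (stUpProb_nonneg z) (stDownProb_nonneg z),
    ← ENNReal.ofReal_add (add_nonneg (stUpProb_nonneg z) (stDownProb_nonneg z)) (stStayProb_nonneg z)]
  have e : stUpProb X μ β K z + stDownProb X μ β K z + (1 - stUpProb X μ β K z - stDownProb X μ β K z) = 1 := by
    ring
  rw [e, ENNReal.ofReal_one]

/-- Integration against the level kernel: `∫⁻ g dκ(z,·) = u·g(k+1,x) + d·g(k−1,x) + (1−u−d)·g(z)`. [ours] -/
theorem lintegral_stLevelKernel (hXm : Measurable X) {g : Fin (K + 1) × Ω → ℝ≥0∞} (hg : Measurable g)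
    (z : Fin (K + 1) × Ω) :
    ∫⁻ y, g y ∂(stLevelKernel hXm μ β K z) =
      ENNReal.ofReal (stUpProb X μ β K z) * g (levUp K z.1, z.2) +
        ENNReal.ofReal (stDownProb X μ β K z) * g (levDown K z.1, z.2) +
        ENNReal.ofReal (1 - stUpProb X μ β K z - stDownProb X μ β K z) * g z := by
  rw [stLevelKernel_apply]
  simp only [stLevelMeasure, lintegral_add_measure, lintegral_smul_measure, lintegral_dirac' _ hg, smul_eq_mul]

end KernelDef

/-! ## §3 (ii) nearest-neighbour moves; (iii) the move probabilities -/

section Moves2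

variable {Ω : Type*} [MeasurableSpace Ω] {X : Ω → ℝ} {μ : Measure Ω} {β : ℕ → ℝ} {K : ℕ}

/-- `|m − n| ≤ 1` for naturals one step apart. [folklore] -/
theorem abs_natCast_sub_le_one {m n : ℕ} (h1 : m ≤ n + 1) (h2 : n ≤ m + 1) : |((m : ℕ) : ℝ) - n| ≤ 1 := by
  rw [abs_le]
  constructor
  · have : (n : ℝ) ≤ (m : ℝ) + 1 := by exact_mod_cast h2
    linarith
  · have : (m : ℝ) ≤ (n : ℝ) + 1 := by exact_mod_cast h1
    linarith

/-- **(ii) THE LEVEL KERNEL MOVES THE LEVEL BY AT MOST ONE RUNG.** [ours] -/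
theorem stLevelKernel_nearestNeighbour (hXm : Measurable X) (z : Fin (K + 1) × Ω) :
    ∀ᵐ y ∂(stLevelKernel hXm μ β K z), |(((y.1 : Fin (K + 1)) : ℕ) : ℝ) - ((z.1 : Fin (K + 1)) : ℕ)| ≤ 1 := by
  rw [ae_iff]
  set S : Set (Fin (K + 1) × Ω) :=
    {y | ¬ |(((y.1 : Fin (K + 1)) : ℕ) : ℝ) - ((z.1 : Fin (K + 1)) : ℕ)| ≤ 1} with hS_def
  have e : S = (fun y : Fin (K + 1) × Ω => ((y.1 : Fin (K + 1)) : ℕ)) ⁻¹'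
      {n : ℕ | ¬ |((n : ℕ) : ℝ) - ((z.1 : Fin (K + 1)) : ℕ)| ≤ 1} := by
    ext y; simp [hS_def]
  have hS : MeasurableSet S := by rw [e]; exact measurable_stLevel MeasurableSet.of_discrete
  rw [stLevelKernel_apply' hXm z hS]
  have h1 : ((levUp K z.1, z.2) : Fin (K + 1) × Ω) ∉ S := by
    rw [hS_def, Set.mem_setOf_eq, not_not, levUp_val]
    exact abs_natCast_sub_le_one (by omega) (by omega)
  have h2 : ((levDown K z.1, z.2) : Fin (K + 1) × Ω) ∉ S := by
    rw [hS_def, Set.mem_setOf_eq, not_not, levDown_val]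
    exact abs_natCast_sub_le_one (by omega) (by omega)
  have h3 : z ∉ S := by
    rw [hS_def, Set.mem_setOf_eq, not_not, sub_self, abs_zero]; exact zero_le_one
  rw [Set.indicator_of_notMem h1, Set.indicator_of_notMem h2, Set.indicator_of_notMem h3]
  simp

/-- **(iii, up) THE PROBABILITY OF MOVING UP FROM `(k, x)` IS `u(k, x)`** (`k < K`). [ours] -/
theorem stLevelKernel_real_up (hXm : Measurable X) (k : Fin (K + 1)) (x : Ω) (hk : (k : ℕ) < K) :
    (stLevelKernel hXm μ β K (k, x)).real {y | ((y.1 : Fin (K + 1)) : ℕ) = (k : ℕ) + 1} =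
      stUpProb X μ β K (k, x) := by
  set S : Set (Fin (K + 1) × Ω) := {y | ((y.1 : Fin (K + 1)) : ℕ) = (k : ℕ) + 1} with hS_def
  have hS : MeasurableSet S := measurable_stLevel (measurableSet_singleton _)
  rw [measureReal_def, stLevelKernel_apply' hXm _ hS]
  have h1 : ((levUp K k, x) : Fin (K + 1) × Ω) ∈ S := by
    rw [hS_def, Set.mem_setOf_eq]; exact levUp_val_of_lt hk
  have h2 : ((levDown K k, x) : Fin (K + 1) × Ω) ∉ S := by
    rw [hS_def, Set.mem_setOf_eq, levDown_val]; omega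
  have h3 : ((k, x) : Fin (K + 1) × Ω) ∉ S := by
    rw [hS_def, Set.mem_setOf_eq]; simp
  rw [Set.indicator_of_mem h1, Set.indicator_of_notMem h2, Set.indicator_of_notMem h3]
  simp only [Pi.one_apply, mul_one, mul_zero, add_zero]
  exact ENNReal.toReal_ofReal (stUpProb_nonneg _)

/-- **(iii, down) THE PROBABILITY OF MOVING DOWN FROM `(k, x)` IS `d(k, x)`** (`k ≥ 1`). [ours] -/
theorem stLevelKernel_real_down (hXm : Measurable X) (k : Fin (K + 1)) (x : Ω) (hk : 1 ≤ (k : ℕ)) :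
    (stLevelKernel hXm μ β K (k, x)).real {y | ((y.1 : Fin (K + 1)) : ℕ) + 1 = (k : ℕ)} =
      stDownProb X μ β K (k, x) := by
  set S : Set (Fin (K + 1) × Ω) := {y | ((y.1 : Fin (K + 1)) : ℕ) + 1 = (k : ℕ)} with hS_def
  have e : S = (fun y : Fin (K + 1) × Ω => ((y.1 : Fin (K + 1)) : ℕ)) ⁻¹' {n : ℕ | n + 1 = (k : ℕ)} := by
    ext y; simp [hS_def]
  have hS : MeasurableSet S := by rw [e]; exact measurable_stLevel MeasurableSet.of_discrete
  rw [measureReal_def, stLevelKernel_apply' hXm _ hS]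
  have h1 : ((levUp K k, x) : Fin (K + 1) × Ω) ∉ S := by
    rw [hS_def, Set.mem_setOf_eq, levUp_val]; omega
  have h2 : ((levDown K k, x) : Fin (K + 1) × Ω) ∈ S := by
    rw [hS_def, Set.mem_setOf_eq, levDown_val]; omega
  have h3 : ((k, x) : Fin (K + 1) × Ω) ∉ S := by
    rw [hS_def, Set.mem_setOf_eq]; simp
  rw [Set.indicator_of_notMem h1, Set.indicator_of_mem h2, Set.indicator_of_notMem h3]
  simp only [Pi.one_apply, mul_one, mul_zero, add_zero, zero_add]
  exact ENNReal.toReal_ofReal (stDownProb_nonneg _)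

/-- **Hypothesis (iii, up) of the GEN-13 law holds for the level kernel.** [ours] -/
theorem stLevelKernel_hup (hXm : Measurable X) (k : Fin (K + 1)) (x : Ω) (hk : (k : ℕ) < K) :
    (stLevelKernel hXm μ β K (k, x)).real {y | ((y.1 : Fin (K + 1)) : ℕ) = (k : ℕ) + 1} ≤
      min 1 ((Real.exp (β ((k : ℕ) + 1) * X x) / mgf X μ (β ((k : ℕ) + 1))) /
        (Real.exp (β (k : ℕ) * X x) / mgf X μ (β (k : ℕ)))) := by
  rw [stLevelKernel_real_up hXm k x hk]; exact stUpProb_le_ratio k x hk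

/-- **Hypothesis (iii, down) of the GEN-13 law holds for the level kernel.** [ours] -/
theorem stLevelKernel_hdown (hXm : Measurable X) (k : Fin (K + 1)) (x : Ω) (hk : 1 ≤ (k : ℕ)) :
    (stLevelKernel hXm μ β K (k, x)).real {y | ((y.1 : Fin (K + 1)) : ℕ) + 1 = (k : ℕ)} ≤
      min 1 ((Real.exp (β ((k : ℕ) - 1) * X x) / mgf X μ (β ((k : ℕ) - 1))) /
        (Real.exp (β (k : ℕ) * X x) / mgf X μ (β (k : ℕ)))) := by
  rw [stLevelKernel_real_down hXm k x hk]; exact stDownProb_le_ratio k x hk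

end Moves2

end Summit.Ventures.LatticeQCDFlow.Scaling

end
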